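import Literature.Computability.QuantumComplexity.ApproxBosonSamplingAccounting
import Literature.Computability.QuantumComplexity.HaarUnitaryHiding
import Literature.Computability.Complexity.CountingHierarchyProofs
import Mathlib.MeasureTheory.Function.Floor
import HarnessLib

/-!
# Approximate BosonSampling: the ideal side of Aaronson–Arkhipov's proof of Thm. 1.3

Family `quantum-advantage`; sequel of `ApproxBosonSamplingAccounting.lean` (the accounting of
S. Aaronson, A. Arkhipov, *The computational complexity of linear optics*, Theory of Computing 9
(2013) 143–252 (AA13), proof of Thm. 1.3, eqs. (5.78)–(5.97), pp. 193–195). That proof analyses its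
`FBPP^{NP^𝒪}` machine on an *ideal* process — "we could have equally well generated the pair
`⟨X, A⟩` by first sampling `A` from the Haar measure `ℋ_{m,n}` and then setting `X := √m A_{S*}` for
`S*` chosen uniformly" (p. 194) — and this file carries out exactly that part of the analysis in the
tree's model, for an arbitrary approximate BosonSampling oracle `𝒪` (Def. 3.11) and an arbitrary
Stockmeyer counter (Thm. 4.1) for the coin predicate `samplerRel (oracleRandAlg 𝒪 c)`:

* the ideal hidden matrix: `A = firstCols h U`, the first `n` columns of a Haar-random
  `U ∈ U(n+e)` (AA13's `A ∼ ℋ_{m,n}`, `m = n + e`), column-orthonormal for *every* `U`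
  (`isColumnOrthonormal_firstCols`), with planted block `A_ι = (scaledRowSubmatrix ι U)/√m`
  (`firstCols_submatrix`, so `√m A_ι ∼ 𝒮_{m,n}` by `map_scaledRowSubmatrix_haar_eq_truncatedHaarMeasure`);
* the quantities the machine computes from what the oracle sees, as functions of the *code*
  `round_{b'} A` (`hidingQuery`, `countInstance`, `plantedCount`, `stockCoinLen`,
  `plantedCountEstimate`, `idealMass`; all parameters in `IdealParams`), and the three bad events of
  the union bound (5.94): `stockBad` (the counter misses its accuracy, eq. (5.89)), `deltaBad`
  (`Δ_ι > (ε/2)/mⁿ`, eq. (5.88)) and `massBad` (`q_ι > (8/δ)/mⁿ`, eq. (5.92));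
* **the deterministic core** (`abs_rescaled_sub_le_of_not_bad`): outside the three bad events, if the
  planted block is `X/√m`, the rescaled estimate `n!·mⁿ·Ñ/2^ℓ` is within `ε·n!` of `|Per X|²`
  (eqs. (5.93)–(5.95) with (5.78)–(5.79));
* **the ideal-side probability bound** (`avg_haar_idealBad_le`): for `U` Haar-random, `ι` uniform and
  the counter's coins uniform, the bad event has probability at most `1/kδS + δ/4 + δ/4` — written,
  as `GPERandOracleSolves` writes joint probabilities, as an average over the finite coordinates of
  the Haar measure of the sections (eqs. (5.88), (5.89), (5.92), from the symmetry principle and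
  Markov counting of `ApproxBosonSamplingAccounting.lean`).

What then remains of the proof of Thm. 1.3 (`gpeSolvableInFBPPRel_NPRel_of_approxBosonSamplingOracle`)
is the *real* side: a finite-precision Hiding Lemma 5.8 (a sampler producing, from `X ∼ 𝒢^{n×n}` and
coins, the code `round_{b'} A` and the position `ι` of a pair `(A, ι)` whose law, when `X ∼ 𝒮_{m,n}`
instead, is exactly the ideal one above) together with Thm. 5.1 (`haarUnitaryTruncation_tv`,
`‖𝒮_{m,n} − 𝒢^{n×n}‖ = O(δ)`) to pass from `𝒢` to `𝒮`, and the machines (`samplerRel (oracleRandAlg 𝒪 c) ∈ P^𝒪`,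
the sampler and the plumbing in `FP`, composition in `FP^{NP^𝒪}`).

## Design choices

* `m = n + e` throughout (the row type `Fin (n + e)` of `encodingBosonInput`), `h : n ≤ n + e`.
* Everything the machine computes depends on the hidden matrix only through the integer code
  `roundEntries b' A : Fin (n+e) → Fin n → ℤ × ℤ` (a countable discrete type), so measurability in
  `U` of all machine-side quantities is composition with the measurable rounding
  (`measurable_roundEntries_firstCols`); the planted probability `|Per(A_ι)|²/n!` is continuous in `U`.
* The Stockmeyer counter is fed the prefix of length `stockCoinLen` (its own coin polynomial at the
  actual instance) of a coin block of fixed length `ℓ₂`; the bad event includes `stockCoinLen ≤ ℓ₂`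
  (where this fails nothing is claimed; the real side guarantees it from the length bound of the
  sampler's output), so that its probability is `≤ 1/kδS` unconditionally (`uniformProb_take_of_le`).

## References

* S. Aaronson, A. Arkhipov, *The computational complexity of linear optics*, Theory of Computing 9
  (2013) 143–252: proof of Thm. 1.3, §5.2, eqs. (5.78)–(5.97) (pp. 193–195); Def. 3.11 (p. 174);
  Thm. 4.1 (p. 175); §5.1 (p. 183, `ℋ_{m,n}`, `𝒮_{m,n}`).
-/

open MeasureTheory Matrix Finset Computability Literature.Computability.Cryptography
  Literature.Computability.Complexity
open scoped ENNReal

namespace Literature.Computability.QuantumComplexity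

variable {n e : ℕ}

/-! ### The ideal hidden matrix: the first `n` columns of a Haar unitary -/

/-- `firstCols h U`: the `(n+e) × n` matrix of the first `n` columns of `U ∈ U(n+e)`; for `U`
Haar-random this is AA13's `A ∼ ℋ_{m,n}`, "the Haar measure over `m × n` column-orthonormal
matrices" (`m = n + e`). [cite: AaronsonArkhipovToC2013, §5.1 (p. 183) and Lemma 5.8 (ii) (p. 191)] -/
def firstCols (h : n ≤ n + e) (U : Matrix.unitaryGroup (Fin (n + e)) ℂ) :
    Matrix (Fin (n + e)) (Fin n) ℂ :=
  (U : Matrix (Fin (n + e)) (Fin (n + e)) ℂ).submatrix id (Fin.castLE h)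

/-- Entries of `firstCols`. [folklore] -/
@[simp] theorem firstCols_apply (h : n ≤ n + e) (U : Matrix.unitaryGroup (Fin (n + e)) ℂ)
    (i : Fin (n + e)) (j : Fin n) :
    firstCols h U i j = (U : Matrix (Fin (n + e)) (Fin (n + e)) ℂ) i (Fin.castLE h j) :=
  rfl

/-- **The first `n` columns of a unitary are orthonormal**: `firstCols h U ∈ 𝒰_{m,n}` for *every*
`U ∈ U(m)` (so the oracle's guarantee of Def. 3.11 applies to every ideal hidden matrix, not only
almost surely). [cite: AaronsonArkhipovToC2013, §5.1 (p. 183)] -/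
theorem isColumnOrthonormal_firstCols (h : n ≤ n + e) (U : Matrix.unitaryGroup (Fin (n + e)) ℂ) :
    IsColumnOrthonormal (firstCols h U) := by
  have hU : (U : Matrix (Fin (n + e)) (Fin (n + e)) ℂ)ᴴ * (U : Matrix (Fin (n + e)) (Fin (n + e)) ℂ)
      = 1 := by
    have := Unitary.star_mul_self_of_mem U.2
    simpa [Matrix.star_eq_conjTranspose] using this
  unfold IsColumnOrthonormal firstCols
  rw [conjTranspose_submatrix, ← Matrix.submatrix_mul _ _ _ _ _ Function.bijective_id, hU,
    Matrix.submatrix_one _ (Fin.castLE_injective h)]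

/-- **The planted block of the ideal hidden matrix is the scaled row submatrix over `√m`**:
`(firstCols U)_ι = (√m · U_{ι,[n]}) / √m`, i.e. `√m A_ι` is the tree's `scaledRowSubmatrix ι U`,
whose law under Haar is `𝒮_{m,n}` for every injective `ι`
(`map_scaledRowSubmatrix_haar_eq_truncatedHaarMeasure`). (AA13 p. 194: "setting `X := √m A_{S*}`".)
[cite: AaronsonArkhipovToC2013, proof of Thm. 1.3, symmetry principle (p. 194)] -/
theorem firstCols_submatrix (h : n ≤ n + e) (hm : 0 < n + e)
    (U : Matrix.unitaryGroup (Fin (n + e)) ℂ) (ι : Fin n ↪ Fin (n + e)) :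
    (firstCols h U).submatrix ι id =
      ((Real.sqrt (n + e : ℕ))⁻¹ : ℝ) • Matrix.of (scaledRowSubmatrix n h ι U) := by
  have hs : (Real.sqrt (n + e : ℕ) : ℂ) ≠ 0 := by
    have : 0 < Real.sqrt (n + e : ℕ) := Real.sqrt_pos.2 (by exact_mod_cast hm)
    exact_mod_cast this.ne'
  ext i j
  rw [Matrix.submatrix_apply, Matrix.smul_apply, Matrix.of_apply, scaledRowSubmatrix_apply,
    firstCols_apply, Complex.real_smul, Complex.ofReal_inv, ← mul_assoc, inv_mul_cancel₀ hs, one_mul]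
  rfl

/-- Each entry of `U ∈ U(m)` depends continuously on `U`. [folklore] -/
theorem continuous_unitaryGroup_apply (i j : Fin (n + e)) :
    Continuous fun U : Matrix.unitaryGroup (Fin (n + e)) ℂ =>
      (U : Matrix (Fin (n + e)) (Fin (n + e)) ℂ) i j :=
  (continuous_apply j).comp ((continuous_apply i).comp continuous_subtype_val)

/-- **The planted probability is continuous in the hidden unitary**: `U ↦ |Per((firstCols U)_ι)|²/n!`
is a polynomial in the entries. [folklore] -/
theorem continuous_norm_sq_permanent_firstCols (h : n ≤ n + e) (ι : Fin n ↪ Fin (n + e)) :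
    Continuous fun U : Matrix.unitaryGroup (Fin (n + e)) ℂ =>
      ‖((firstCols h U).submatrix ι id).permanent‖ ^ 2 / n.factorial := by
  have hper : Continuous fun U : Matrix.unitaryGroup (Fin (n + e)) ℂ =>
      ((firstCols h U).submatrix ι id).permanent := by
    unfold Matrix.permanent
    refine continuous_finsetSum _ fun σ _ => continuous_finsetProd _ fun i _ => ?_
    exact continuous_unitaryGroup_apply _ _
  exact ((continuous_norm.comp hper).pow 2).div_const _

/-! ### Measurability of the rounding -/

/-- Rounding a real number to the nearest integer is measurable. [folklore] -/
theorem measurable_round_real : Measurable (round : ℝ → ℤ) := by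
  have : (round : ℝ → ℤ) = fun x => ⌊x + 1 / 2⌋ := funext fun x => round_eq x
  rw [this]
  exact Int.measurable_floor.comp (measurable_id.add_const _)

/-- Rounding a complex number to the dyadic grid of precision `b` is measurable. [folklore] -/
theorem measurable_roundDyadic (b : ℕ) : Measurable (roundDyadic b) := by
  unfold roundDyadic
  refine Measurable.prodMk ?_ ?_
  · exact measurable_round_real.comp (Complex.measurable_re.const_mul _)
  · exact measurable_round_real.comp (Complex.measurable_im.const_mul _)

/-- **What the oracle sees is a measurable function of the hidden unitary**: the code
`round_{b'}(firstCols U)` (a point of the countable discrete type `Fin (n+e) → Fin n → ℤ × ℤ`) depends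
measurably on `U`. [folklore] -/
theorem measurable_roundEntries_firstCols (h : n ≤ n + e) (b : ℕ) :
    Measurable fun U : Matrix.unitaryGroup (Fin (n + e)) ℂ => roundEntries b (firstCols h U) := by
  refine measurable_pi_iff.2 fun i => measurable_pi_iff.2 fun j => ?_
  exact (measurable_roundDyadic b).comp (continuous_unitaryGroup_apply i (Fin.castLE h j)).measurable

/-- Hence every quantity computed from that code is a measurable function of `U`. [folklore] -/
theorem measurable_comp_roundEntries_firstCols {β : Type*} [MeasurableSpace β] (h : n ≤ n + e)
    (b : ℕ) (g : (Fin (n + e) → Fin n → ℤ × ℤ) → β) :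
    Measurable fun U : Matrix.unitaryGroup (Fin (n + e)) ℂ => g (roundEntries b (firstCols h U)) :=
  (measurable_of_countable g).comp (measurable_roundEntries_firstCols h b)

/-! ### What the machine computes from the code of the hidden matrix -/

/-- The data of the two black boxes of the proof of Thm. 1.3 and their parameters: the approximate
BosonSampling oracle `𝒪` with its coin polynomial `c` (Def. 3.11), queried at precision `b'` and
accuracy `kβ = 1/β`; and the Stockmeyer counter `F` for the coin predicate `samplerRel (oracleRandAlg 𝒪 c)` with its coin
polynomial `cS`, accuracy `kη = 1/η` and confidence `kδS`, fed `ℓ₂` coins (Thm. 4.1 as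
`stockmeyerApproxCounting`). [cite: AaronsonArkhipovToC2013, proof of Thm. 1.3 (pp. 193–194)] -/
structure IdealParams where
  /-- the approximate BosonSampling oracle -/
  𝒪 : Oracle
  /-- its coin-length polynomial -/
  c : Polynomial ℕ
  /-- the query precision `b'` -/
  b' : ℕ
  /-- the query accuracy `kβ = 1/β` -/
  kβ : ℕ
  /-- the Stockmeyer transducer (with its `NP^𝒪` oracle folded in) -/
  F : List Bool → List Bool
  /-- its coin-length polynomial -/
  cS : Polynomial ℕ
  /-- its accuracy `kη = 1/η` -/
  kη : ℕ
  /-- its confidence `kδS` -/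
  kδS : ℕ
  /-- the number of coins supplied to it -/
  ℓ₂ : ℕ

namespace IdealParams

variable (P : IdealParams)

/-- The padded oracle query `x' = ⟨⟨n, e, b', E⟩, 1^{kβ}⟩` on the code `E` of the hidden matrix
(AA13: "Suppose we feed `⟨A, 0^{1/β}, r⟩` to … `𝒪`", p. 193). [cite: AaronsonArkhipovToC2013, proof of Thm. 1.3 (p. 193)] -/
def hidingQuery (E : Fin (n + e) → Fin n → ℤ × ℤ) : List Bool :=
  boolPair (encodingBosonInput.encode ⟨n, e, P.b', E⟩) (unaryEncodeNat P.kβ)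

/-- The oracle's coin length at that query, `ℓ = c(|x'|)`. [cite: AaronsonArkhipovToC2013, Def. 3.11 (p. 174)] -/
def oracleCoinLen (E : Fin (n + e) → Fin n → ℤ × ℤ) : ℕ :=
  P.c.eval (P.hidingQuery E).length

/-- The counting instance `⟨x', S*_ι⟩` handed to the Stockmeyer counter (eq. (5.80)).
[cite: AaronsonArkhipovToC2013, proof of Thm. 1.3, eq. (5.80) (p. 193)] -/
def countInstance (E : Fin (n + e) → Fin n → ℤ × ℤ) (ι : Fin n ↪ Fin (n + e)) : List Bool :=
  boolPair (P.hidingQuery E) (plantedOutcome ι)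

/-- The number being counted: `N = #{r ∈ {0,1}^ℓ | 𝒪(⟨x', r⟩) = S*_ι} = 2^ℓ q_{S*}` (eq. (5.80)).
[cite: AaronsonArkhipovToC2013, proof of Thm. 1.3, eq. (5.80) (p. 193)] -/
noncomputable def plantedCount (E : Fin (n + e) → Fin n → ℤ × ℤ) (ι : Fin n ↪ Fin (n + e)) : ℕ :=
  countWitnesses (samplerRel (oracleRandAlg P.𝒪 P.c)) (P.oracleCoinLen E) (P.countInstance E ι)

/-- `q_ι = N / 2^ℓ`, the oracle's mass at the planted outcome (eq. (5.80)). [cite: AaronsonArkhipovToC2013, proof of Thm. 1.3, eq. (5.80) (p. 193)] -/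
noncomputable def idealMass (E : Fin (n + e) → Fin n → ℤ × ℤ) (ι : Fin n ↪ Fin (n + e)) : ℝ :=
  (P.plantedCount E ι : ℝ) / 2 ^ P.oracleCoinLen E

/-- The number of coins the Stockmeyer counter uses at this instance: its coin polynomial at
`|⟨x', S*_ι⟩| + ℓ + kη + kδS`. [cite: AaronsonArkhipovToC2013, Thm. 4.1 (p. 175)] -/
def stockCoinLen (E : Fin (n + e) → Fin n → ℤ × ℤ) (ι : Fin n ↪ Fin (n + e)) : ℕ :=
  P.cS.eval ((P.countInstance E ι).length + P.oracleCoinLen E + P.kη + P.kδS)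

/-- The counter's estimate `Ñ` of `N`, run on the prefix of the coin block `u₂` it needs
(eq. (5.89)). [cite: AaronsonArkhipovToC2013, proof of Thm. 1.3, eq. (5.89) (p. 194)] -/
def plantedCountEstimate (E : Fin (n + e) → Fin n → ℤ × ℤ) (ι : Fin n ↪ Fin (n + e))
    (u₂ : List Bool) : ℕ :=
  countEstimate P.F (P.countInstance E ι) (P.oracleCoinLen E) P.kη P.kδS
    (u₂.take (P.stockCoinLen E ι))

/-- **`q_ι` is the planted mass of the oracle's output law** `𝒟'` at the padded query
(`oracleSamplePMF`, Def. 3.11), by `plantedMass_oracleSamplePMF`. [cite: AaronsonArkhipovToC2013, proof of Thm. 1.3, eq. (5.80) (p. 193)] -/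
theorem idealMass_eq_plantedMass (E : Fin (n + e) → Fin n → ℤ × ℤ) (ι : Fin n ↪ Fin (n + e)) :
    P.idealMass E ι =
      plantedMass (oracleSamplePMF P.𝒪 P.c (encodingBosonInput.encode ⟨n, e, P.b', E⟩) P.kβ) ι := by
  rw [plantedMass_oracleSamplePMF]
  rfl

/-! ### The three bad events of the union bound (5.94) -/

/-- **Stockmeyer misses** (the complement of eq. (5.89)): the counter's coins fit into the supplied
block but its estimate is not within the factor `1 + 1/kη` of `N`. [cite: AaronsonArkhipovToC2013, proof of Thm. 1.3, eq. (5.89) (p. 194)] -/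
def stockBad (E : Fin (n + e) → Fin n → ℤ × ℤ) (ι : Fin n ↪ Fin (n + e)) (u₂ : List Bool) : Prop :=
  P.stockCoinLen E ι ≤ P.ℓ₂ ∧
    ¬ IsApproxCount P.kη (P.plantedCount E ι) (P.plantedCountEstimate E ι u₂)

/-- **The planted mass is too large**: `q_ι > (8/δ)/mⁿ` (eq. (5.92) with `k = 4/δ`).
[cite: AaronsonArkhipovToC2013, proof of Thm. 1.3, eq. (5.92) (p. 195)] -/
def massBad (δ : ℝ) (E : Fin (n + e) → Fin n → ℤ × ℤ) (ι : Fin n ↪ Fin (n + e)) : Prop :=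
  8 / δ / ((n + e : ℕ) : ℝ) ^ n < P.idealMass E ι

end IdealParams

/-- `p_ι = |Per(A_ι)|²/n!`, the planted probability under `𝒟_A` written directly as a squared
permanent (eq. (5.79), ordered form; equal to `𝒟_A(S*_ι)` for column-orthonormal `A`,
`toReal_bosonTargetPMF_plantedOutcome`). [cite: AaronsonArkhipovToC2013, proof of Thm. 1.3, eq. (5.79) (p. 193)] -/
noncomputable def idealPlantedProb (A : Matrix (Fin (n + e)) (Fin n) ℂ) (ι : Fin n ↪ Fin (n + e)) :
    ℝ :=
  ‖(A.submatrix ι id).permanent‖ ^ 2 / n.factorial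

/-- **The discrepancy is too large**: `Δ_ι = |p_ι − q_ι| > (ε/2)/mⁿ` (eq. (5.88) with `k = 4/δ`,
`β = εδ/24`). [cite: AaronsonArkhipovToC2013, proof of Thm. 1.3, eq. (5.88) (p. 194)] -/
def deltaBad (P : IdealParams) (ε : ℝ) (A : Matrix (Fin (n + e)) (Fin n) ℂ)
    (ι : Fin n ↪ Fin (n + e)) : Prop :=
  ε / 2 / ((n + e : ℕ) : ℝ) ^ n < |idealPlantedProb A ι - P.idealMass (roundEntries P.b' A) ι|

/-- **The bad event of the union bound (5.94)** for the hidden matrix `A`, planted position `ι` and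
counter coins `u₂`: Stockmeyer misses, or the discrepancy is large, or the planted mass is large.
[cite: AaronsonArkhipovToC2013, proof of Thm. 1.3, eq. (5.94) (p. 195)] -/
def idealBad (P : IdealParams) (ε δ : ℝ) (A : Matrix (Fin (n + e)) (Fin n) ℂ)
    (ι : Fin n ↪ Fin (n + e)) (u₂ : List Bool) : Prop :=
  P.stockBad (roundEntries P.b' A) ι u₂ ∨ deltaBad P ε A ι ∨ P.massBad δ (roundEntries P.b' A) ι

/-! ### The deterministic core (eqs. (5.93)–(5.95) with (5.78)–(5.79)) -/

/-- For a column-orthonormal hidden matrix, `p_ι` is the target probability of the planted outcome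
and `Δ_ι` is the `plantedDelta` of `ApproxBosonSamplingAccounting.lean`. [cite: AaronsonArkhipovToC2013, proof of Thm. 1.3, eq. (5.79) (p. 193)] -/
theorem plantedDelta_eq_of_isColumnOrthonormal (P : IdealParams) [NeZero (n + e)]
    {A : Matrix (Fin (n + e)) (Fin n) ℂ} (hA : IsColumnOrthonormal A) (ι : Fin n ↪ Fin (n + e)) :
    plantedDelta A (oracleSamplePMF P.𝒪 P.c
        (encodingBosonInput.encode ⟨n, e, P.b', roundEntries P.b' A⟩) P.kβ) ι =
      |idealPlantedProb A ι - P.idealMass (roundEntries P.b' A) ι| := by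
  rw [plantedDelta, toReal_bosonTargetPMF_plantedOutcome hA ι, P.idealMass_eq_plantedMass]
  rfl

/-- **Outside the bad event the rescaled estimate is good.** If the hidden matrix `A` is
column-orthonormal with planted block `X/√m`, the counter's coins fit (`stockCoinLen ≤ ℓ₂`), its
accuracy is `1/kη ≤ εδ/16 = α`, and none of the three bad events occurs, then
`|n!·mⁿ·Ñ/2^ℓ − |Per X|²| ≤ ε·n!`: eq. (5.89) gives `|q̃ − q| ≤ αq`, eqs. (5.93)–(5.95) give
`|q̃ − p_ι| ≤ ε/mⁿ`, and (5.78)–(5.79) rescale. [cite: AaronsonArkhipovToC2013, proof of Thm. 1.3, eqs. (5.93)–(5.95) (p. 195)] -/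
theorem abs_rescaled_sub_le_of_not_bad (P : IdealParams) [NeZero (n + e)]
    {A : Matrix (Fin (n + e)) (Fin n) ℂ} (hA : IsColumnOrthonormal A) (ι : Fin n ↪ Fin (n + e))
    (X : Matrix (Fin n) (Fin n) ℂ) (hplant : A.submatrix ι id = ((Real.sqrt (n + e : ℕ))⁻¹ : ℝ) • X)
    {ε δ : ℝ} (hε : 0 < ε) (hδ : 0 < δ) (hkη : 0 < P.kη) (hα : 1 / (P.kη : ℝ) ≤ ε * δ / 16)
    (hlen : P.stockCoinLen (roundEntries P.b' A) ι ≤ P.ℓ₂) {u₂ : List Bool}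
    (hgood : ¬ idealBad P ε δ A ι u₂) :
    |(n.factorial : ℝ) * ((n + e : ℕ) : ℝ) ^ n *
        ((P.plantedCountEstimate (roundEntries P.b' A) ι u₂ : ℝ) /
          2 ^ P.oracleCoinLen (roundEntries P.b' A)) - ‖X.permanent‖ ^ 2| ≤ ε * n.factorial := by
  simp only [idealBad, not_or] at hgood
  obtain ⟨hS, hΔ, hM⟩ := hgood
  have hm : 0 < n + e := Nat.pos_of_ne_zero (NeZero.ne _)
  have hMpos : (0 : ℝ) < ((n + e : ℕ) : ℝ) ^ n := by positivity
  set E := roundEntries P.b' A with hE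
  set L : ℝ := 2 ^ P.oracleCoinLen E with hL
  have hL0 : 0 < L := by positivity
  -- Stockmeyer's accuracy (5.89)
  have happrox : IsApproxCount P.kη (P.plantedCount E ι) (P.plantedCountEstimate E ι u₂) := by
    by_contra h
    exact hS ⟨hlen, h⟩
  have hacc := abs_sub_le_of_isApproxCount hkη happrox hL0
  -- in terms of `q = N/L`, `q̃ = Ñ/L`, `p = p_ι`
  set q : ℝ := (P.plantedCount E ι : ℝ) / L with hq
  set qt : ℝ := (P.plantedCountEstimate E ι u₂ : ℝ) / L with hqt
  have hq_def : P.idealMass E ι = q := rfl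
  have hq0 : 0 ≤ q := by positivity
  have hacc' : |qt - q| ≤ ε * δ / 16 * q :=
    hacc.trans (mul_le_mul_of_nonneg_right hα hq0)
  have hmass : q ≤ 8 / δ / ((n + e : ℕ) : ℝ) ^ n := by
    rw [← hq_def]; exact not_lt.1 hM
  have hdelta : |idealPlantedProb A ι - q| ≤ ε / 2 / ((n + e : ℕ) : ℝ) ^ n := by
    rw [← hq_def]; exact not_lt.1 hΔ
  have hest : |qt - idealPlantedProb A ι| ≤ ε / ((n + e : ℕ) : ℝ) ^ n :=
    abs_estimate_sub_planted_le hδ hMpos hacc' hmass hdelta hε.le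
  -- `p_ι` is the target probability of the planted outcome; rescale by `n! mⁿ`
  have hp : idealPlantedProb A ι = (bosonTargetPMF A (plantedOutcome ι)).toReal := by
    rw [toReal_bosonTargetPMF_plantedOutcome hA ι]; rfl
  rw [hp] at hest
  exact abs_rescaled_estimate_sub_le hA ι X hplant hest

/-! ### Measurability of the bad events in the hidden unitary -/

section Measurability

variable (P : IdealParams) (h : n ≤ n + e)

/-- The Stockmeyer-bad section is measurable in `U` (it depends on `U` through the code only).
[folklore] -/
theorem measurableSet_stockBad (ι : Fin n ↪ Fin (n + e)) (u₂ : List Bool) :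
    MeasurableSet {U : Matrix.unitaryGroup (Fin (n + e)) ℂ |
      P.stockBad (roundEntries P.b' (firstCols h U)) ι u₂} :=
  measurableSet_setOf.2 (measurable_comp_roundEntries_firstCols h P.b' fun E => P.stockBad E ι u₂)

/-- The mass-bad section is measurable in `U`. [folklore] -/
theorem measurableSet_massBad (δ : ℝ) (ι : Fin n ↪ Fin (n + e)) :
    MeasurableSet {U : Matrix.unitaryGroup (Fin (n + e)) ℂ |
      P.massBad δ (roundEntries P.b' (firstCols h U)) ι} :=
  measurableSet_setOf.2 (measurable_comp_roundEntries_firstCols h P.b' fun E => P.massBad δ E ι)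

/-- The discrepancy `U ↦ |p_ι − q_ι|` is measurable in `U` (continuous minus code-measurable).
[folklore] -/
theorem measurable_discrepancy (ι : Fin n ↪ Fin (n + e)) :
    Measurable fun U : Matrix.unitaryGroup (Fin (n + e)) ℂ =>
      |idealPlantedProb (firstCols h U) ι - P.idealMass (roundEntries P.b' (firstCols h U)) ι| := by
  refine Measurable.abs (Measurable.sub ?_ ?_)
  · exact (continuous_norm_sq_permanent_firstCols h ι).measurable
  · exact measurable_comp_roundEntries_firstCols h P.b' fun E => P.idealMass E ι

/-- The delta-bad section is measurable in `U`. [folklore] -/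
theorem measurableSet_deltaBad (ε : ℝ) (ι : Fin n ↪ Fin (n + e)) :
    MeasurableSet {U : Matrix.unitaryGroup (Fin (n + e)) ℂ | deltaBad P ε (firstCols h U) ι} :=
  measurableSet_lt measurable_const (measurable_discrepancy P h ι)

/-- The bad section is measurable in `U`. [folklore] -/
theorem measurableSet_idealBad (ε δ : ℝ) (ι : Fin n ↪ Fin (n + e)) (u₂ : List Bool) :
    MeasurableSet {U : Matrix.unitaryGroup (Fin (n + e)) ℂ |
      idealBad P ε δ (firstCols h U) ι u₂} :=
  (measurableSet_stockBad P h ι u₂).union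
    ((measurableSet_deltaBad P h ε ι).union (measurableSet_massBad P h δ ι))

end Measurability


/-! ### Measurability in the entries of the hidden matrix (array form, for laws on `ℂ^{(n+e)×n}`) -/

section ArrayMeasurability

variable (P : IdealParams)

/-- The planted probability `|Per(A_ι)|²/n!` is continuous in the entries of the hidden matrix.
[folklore] -/
theorem continuous_idealPlantedProb_of (ι : Fin n ↪ Fin (n + e)) :
    Continuous fun a : Fin (n + e) → Fin n → ℂ => idealPlantedProb (Matrix.of a) ι := by
  unfold idealPlantedProb
  have hper : Continuous fun a : Fin (n + e) → Fin n → ℂ =>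
      ((Matrix.of a).submatrix ι id).permanent := by
    unfold Matrix.permanent
    refine continuous_finsetSum _ fun σ _ => continuous_finsetProd _ fun i _ => ?_
    exact (continuous_apply _).comp (continuous_apply _)
  exact ((continuous_norm.comp hper).pow 2).div_const _

/-- The code `round_{b} A` is a measurable function of the entries of `A`. [folklore] -/
theorem measurable_roundEntries_of (b : ℕ) :
    Measurable fun a : Fin (n + e) → Fin n → ℂ => roundEntries b (Matrix.of a) := by
  refine measurable_pi_iff.2 fun i => measurable_pi_iff.2 fun j => ?_
  exact (measurable_roundDyadic b).comp ((measurable_pi_apply j).comp (measurable_pi_apply i))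

/-- Hence every quantity computed from that code is a measurable function of the entries. [folklore] -/
theorem measurable_comp_roundEntries_of {β : Type*} [MeasurableSpace β] (b : ℕ)
    (g : (Fin (n + e) → Fin n → ℤ × ℤ) → β) :
    Measurable fun a : Fin (n + e) → Fin n → ℂ => g (roundEntries b (Matrix.of a)) :=
  (measurable_of_countable g).comp (measurable_roundEntries_of b)

/-- **The bad event is a measurable set of hidden matrices** (arrays of entries): the Stockmeyer
and mass events factor through the code, the discrepancy is continuous minus code-measurable.
[folklore] -/
theorem measurableSet_idealBad_of (ε δ : ℝ) (ι : Fin n ↪ Fin (n + e)) (u₂ : List Bool) :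
    MeasurableSet {a : Fin (n + e) → Fin n → ℂ | idealBad P ε δ (Matrix.of a) ι u₂} := by
  have h1 : MeasurableSet {a : Fin (n + e) → Fin n → ℂ |
      P.stockBad (roundEntries P.b' (Matrix.of a)) ι u₂} :=
    measurableSet_setOf.2 (measurable_comp_roundEntries_of P.b' fun E => P.stockBad E ι u₂)
  have h2 : MeasurableSet {a : Fin (n + e) → Fin n → ℂ | deltaBad P ε (Matrix.of a) ι} := by
    refine measurableSet_lt measurable_const (Measurable.abs (Measurable.sub ?_ ?_))
    · exact (continuous_idealPlantedProb_of ι).measurable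
    · exact measurable_comp_roundEntries_of P.b' fun E => P.idealMass E ι
  have h3 : MeasurableSet {a : Fin (n + e) → Fin n → ℂ |
      P.massBad δ (roundEntries P.b' (Matrix.of a)) ι} :=
    measurableSet_setOf.2 (measurable_comp_roundEntries_of P.b' fun E => P.massBad δ E ι)
  exact h1.union (h2.union h3)

/-- The array of entries of `firstCols h U` depends continuously on `U`. [folklore] -/
theorem continuous_entries_firstCols (h : n ≤ n + e) :
    Continuous fun U : Matrix.unitaryGroup (Fin (n + e)) ℂ =>
      (fun i j => firstCols h U i j : Fin (n + e) → Fin n → ℂ) :=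
  continuous_pi fun i => continuous_pi fun j => continuous_unitaryGroup_apply i (Fin.castLE h j)

/-- `firstCols h U` is recovered from its array of entries. [folklore] -/
@[simp] theorem of_entries_firstCols (h : n ≤ n + e) (U : Matrix.unitaryGroup (Fin (n + e)) ℂ) :
    Matrix.of (fun i j => firstCols h U i j) = firstCols h U := rfl

end ArrayMeasurability

/-! ### The ideal-side probability bound (eqs. (5.88), (5.89), (5.92)) -/

/-- From a `uniformProb` bound to a count: if every string satisfying `p` lies in an event of
uniform probability `≤ c`, then at most `c · 2^m` strings of length `m` satisfy `p`. [folklore] -/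
theorem card_filter_le_of_uniformProb_le {m : ℕ} {T : Set (List Bool)} {c : ℝ}
    (hT : uniformProb m T ≤ c) (p : List.Vector Bool m → Prop) [DecidablePred p]
    (hp : ∀ r, p r → r.toList ∈ T) :
    ((Finset.univ.filter p).card : ℝ) ≤ c * 2 ^ m := by
  classical
  unfold uniformProb at hT
  rw [div_le_iff₀ (by positivity)] at hT
  refine le_trans ?_ hT
  refine Nat.cast_le.2 (Finset.card_le_card ?_)
  intro r hr
  rw [Finset.mem_filter] at hr ⊢
  exact ⟨Finset.mem_univ _, hp r hr.2⟩

open Classical in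
/-- **The Stockmeyer term**: for every hidden matrix code `E` and position `ι`, the fraction of coin
blocks `u₂ ∈ {0,1}^{ℓ₂}` on which the counter misses (and its coins fit) is at most `1/kδS` — the
guarantee of `stockmeyerApproxCounting` at the instance `⟨x', S*_ι⟩`, transported along the prefix
map `u₂ ↦ u₂ ↾ stockCoinLen` (`uniformProb_take_of_le`). [cite: AaronsonArkhipovToC2013, proof of Thm. 1.3, eq. (5.89) (p. 194) with Thm. 4.1 (p. 175)] -/
theorem card_stockBad_le (P : IdealParams) (hδS : 0 < P.kδS)
    (hS : ∀ (x : List Bool) (ℓ : ℕ),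
      uniformProb (P.cS.eval (x.length + ℓ + P.kη + P.kδS))
        {u | ¬ IsApproxCount P.kη (countWitnesses (samplerRel (oracleRandAlg P.𝒪 P.c)) ℓ x)
          (countEstimate P.F x ℓ P.kη P.kδS u)} ≤ 1 / (P.kδS : ℝ))
    (E : Fin (n + e) → Fin n → ℤ × ℤ) (ι : Fin n ↪ Fin (n + e)) :
    ((Finset.univ.filter fun u₂ : List.Vector Bool P.ℓ₂ => P.stockBad E ι u₂.toList).card : ℝ) ≤
      1 / (P.kδS : ℝ) * Fintype.card (List.Vector Bool P.ℓ₂) := by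
  have hcard : (Fintype.card (List.Vector Bool P.ℓ₂) : ℝ) = 2 ^ P.ℓ₂ := by
    rw [card_vector, Fintype.card_bool]; push_cast; ring
  rw [hcard]
  by_cases hfit : P.stockCoinLen E ι ≤ P.ℓ₂
  · set Bad : Set (List Bool) := {u | ¬ IsApproxCount P.kη
        (countWitnesses (samplerRel (oracleRandAlg P.𝒪 P.c)) (P.oracleCoinLen E) (P.countInstance E ι))
        (countEstimate P.F (P.countInstance E ι) (P.oracleCoinLen E) P.kη P.kδS u)} with hBad
    have key0 : uniformProb (P.stockCoinLen E ι) Bad ≤ 1 / (P.kδS : ℝ) :=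
      hS (P.countInstance E ι) (P.oracleCoinLen E)
    have key : uniformProb P.ℓ₂ {y | y.take (P.stockCoinLen E ι) ∈ Bad} ≤ 1 / (P.kδS : ℝ) := by
      rw [uniformProb_take_of_le hfit]; exact key0
    refine card_filter_le_of_uniformProb_le key _ fun r hr => ?_
    simp only [IdealParams.stockBad, IdealParams.plantedCountEstimate, IdealParams.plantedCount] at hr
    simp only [Set.mem_setOf_eq, hBad]
    exact hr.2
  · have hempty : (Finset.univ.filter fun u₂ : List.Vector Bool P.ℓ₂ => P.stockBad E ι u₂.toList) =
        ∅ := by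
      refine Finset.filter_eq_empty_iff.2 fun u _ h' => hfit h'.1
    rw [hempty, Finset.card_empty, Nat.cast_zero]
    positivity

/-- **The ideal-side bound.** Let `𝒪` satisfy Def. 3.11 at precision `b'` and accuracy
`1/kβ ≤ εδ/24` on every orthonormal matrix (`h𝒪`), and let `F` be a Stockmeyer counter for
`samplerRel (oracleRandAlg 𝒪 c)` (`hS`, the conclusion of `stockmeyerApproxCounting`). Then for `U ∼ Haar(U(n+e))`,
a uniformly random planted position `ι` and uniformly random counter coins `u₂ ∈ {0,1}^{ℓ₂}`, all
independent (`3n² ≤ n + e`), the bad event of (5.94) has probability at most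
`1/kδS + δ/4 + δ/4` — AA13's `1/2^m + δ/4 + 1/k` of (5.95), by eq. (5.89) for the counter, eq. (5.88)
(`avg_measureReal_badDelta_le`) for the discrepancy and eq. (5.92) (`avg_measureReal_badMass_le`) for
the mass — written as the average over `(u₂, ι)` of the Haar measure of the sections.
[cite: AaronsonArkhipovToC2013, proof of Thm. 1.3, eqs. (5.88)–(5.95) (pp. 194–195)] -/
theorem avg_haar_idealBad_le (P : IdealParams) (h : n ≤ n + e) {ε δ : ℝ} (hε : 0 < ε) (hδ : 0 < δ)
    (hne : 3 * n ^ 2 ≤ n + e) (hm : 0 < n + e) (hδS : 0 < P.kδS)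
    (hβ : 1 / (P.kβ : ℝ) ≤ ε * δ / 24)
    (h𝒪 : ∀ A : Matrix (Fin (n + e)) (Fin n) ℂ, IsColumnOrthonormal A →
      (oracleSamplePMF P.𝒪 P.c (encodingBosonInput.encode ⟨n, e, P.b', roundEntries P.b' A⟩)
          P.kβ).tvDist (bosonTargetPMF A) ≤ 1 / (P.kβ : ℝ))
    (hS : ∀ (x : List Bool) (ℓ : ℕ),
      uniformProb (P.cS.eval (x.length + ℓ + P.kη + P.kδS))
        {u | ¬ IsApproxCount P.kη (countWitnesses (samplerRel (oracleRandAlg P.𝒪 P.c)) ℓ x)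
          (countEstimate P.F x ℓ P.kη P.kδS u)} ≤ 1 / (P.kδS : ℝ)) :
    (∑ u₂ : List.Vector Bool P.ℓ₂, (∑ ι : Fin n ↪ Fin (n + e),
        (Literature.MathematicalPhysics.QuantumFieldTheory.haarProbability
            (Matrix.unitaryGroup (Fin (n + e)) ℂ)).real
          {U | idealBad P ε δ (firstCols h U) ι u₂.toList}) /
        Fintype.card (Fin n ↪ Fin (n + e))) / 2 ^ P.ℓ₂ ≤
      1 / (P.kδS : ℝ) + δ / 4 + δ / 4 := by
  classical
  set μ := Literature.MathematicalPhysics.QuantumFieldTheory.haarProbability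
    (Matrix.unitaryGroup (Fin (n + e)) ℂ) with hμ
  haveI : NeZero (n + e) := ⟨hm.ne'⟩
  haveI : Nonempty (Fin n ↪ Fin (n + e)) :=
    Fintype.card_pos_iff.1 (card_plantedPositions_pos (Nat.le_add_right n e))
  have hI : (0 : ℝ) < Fintype.card (Fin n ↪ Fin (n + e)) := by exact_mod_cast Fintype.card_pos
  have hV : (0 : ℝ) < 2 ^ P.ℓ₂ := by positivity
  have hcardV : (Fintype.card (List.Vector Bool P.ℓ₂) : ℝ) = 2 ^ P.ℓ₂ := by
    rw [card_vector, Fintype.card_bool]; push_cast; ring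
  -- the three section families
  set S : List.Vector Bool P.ℓ₂ → (Fin n ↪ Fin (n + e)) → Set (Matrix.unitaryGroup (Fin (n + e)) ℂ) :=
    fun u₂ ι => {U | P.stockBad (roundEntries P.b' (firstCols h U)) ι u₂.toList} with hSdef
  set D : (Fin n ↪ Fin (n + e)) → Set (Matrix.unitaryGroup (Fin (n + e)) ℂ) :=
    fun ι => {U | deltaBad P ε (firstCols h U) ι} with hDdef
  set M : (Fin n ↪ Fin (n + e)) → Set (Matrix.unitaryGroup (Fin (n + e)) ℂ) :=
    fun ι => {U | P.massBad δ (roundEntries P.b' (firstCols h U)) ι} with hMdef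
  -- pointwise union bound
  have hunion : ∀ u₂ ι, μ.real {U | idealBad P ε δ (firstCols h U) ι u₂.toList} ≤
      μ.real (S u₂ ι) + μ.real (D ι) + μ.real (M ι) := by
    intro u₂ ι
    have hset : {U | idealBad P ε δ (firstCols h U) ι u₂.toList} = S u₂ ι ∪ (D ι ∪ M ι) := by
      ext U; simp [idealBad, hSdef, hDdef, hMdef]
    rw [hset]
    calc μ.real (S u₂ ι ∪ (D ι ∪ M ι)) ≤ μ.real (S u₂ ι) + μ.real (D ι ∪ M ι) :=
          measureReal_union_le _ _
      _ ≤ μ.real (S u₂ ι) + (μ.real (D ι) + μ.real (M ι)) := by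
          gcongr; exact measureReal_union_le _ _
      _ = _ := by ring
  -- (5.89): the Stockmeyer term, for each `ι`, averaged over `u₂`
  have hStock : ∀ ι, (∑ u₂ : List.Vector Bool P.ℓ₂, μ.real (S u₂ ι)) / 2 ^ P.ℓ₂ ≤ 1 / (P.kδS : ℝ) := by
    intro ι
    have key := avg_measureReal_sections_le μ (fun u₂ => S u₂ ι)
      (fun u₂ => measurableSet_stockBad P h ι u₂.toList) (c := 1 / (P.kδS : ℝ)) (by positivity)
      (ae_of_all μ fun U => card_stockBad_le P hδS hS _ ι)
    rwa [hcardV] at key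
  -- (5.88): the discrepancy term, averaged over `ι`
  have hDelta : (∑ ι : Fin n ↪ Fin (n + e), μ.real (D ι)) / Fintype.card (Fin n ↪ Fin (n + e)) ≤
      δ / 4 := by
    have key := avg_measureReal_badDelta_le μ (firstCols h)
      (fun U => oracleSamplePMF P.𝒪 P.c
        (encodingBosonInput.encode ⟨n, e, P.b', roundEntries P.b' (firstCols h U)⟩) P.kβ)
      hε hδ.le hne
      (ae_of_all μ fun U => (h𝒪 _ (isColumnOrthonormal_firstCols h U)).trans hβ)
      (fun ι => by
        have hset : {U : Matrix.unitaryGroup (Fin (n + e)) ℂ | ε / 2 / ((n + e : ℕ) : ℝ) ^ n <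
            plantedDelta (firstCols h U) (oracleSamplePMF P.𝒪 P.c
              (encodingBosonInput.encode ⟨n, e, P.b', roundEntries P.b' (firstCols h U)⟩) P.kβ) ι}
              = D ι := by
          ext U
          simp only [Set.mem_setOf_eq, hDdef, deltaBad,
            plantedDelta_eq_of_isColumnOrthonormal P (isColumnOrthonormal_firstCols h U)]
        rw [hset]; exact measurableSet_deltaBad P h ε ι)
    refine le_trans (le_of_eq ?_) key
    congr 1
    refine Finset.sum_congr rfl fun ι _ => ?_
    congr 1
    ext U
    simp only [Set.mem_setOf_eq, hDdef, deltaBad,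
      plantedDelta_eq_of_isColumnOrthonormal P (isColumnOrthonormal_firstCols h U)]
  -- (5.92): the mass term, averaged over `ι`
  have hMass : (∑ ι : Fin n ↪ Fin (n + e), μ.real (M ι)) / Fintype.card (Fin n ↪ Fin (n + e)) ≤
      δ / 4 := by
    have key := avg_measureReal_badMass_le μ
      (fun U : Matrix.unitaryGroup (Fin (n + e)) ℂ => oracleSamplePMF P.𝒪 P.c
        (encodingBosonInput.encode ⟨n, e, P.b', roundEntries P.b' (firstCols h U)⟩) P.kβ)
      hδ hne hm
      (fun ι => by
        have hset : {U : Matrix.unitaryGroup (Fin (n + e)) ℂ | 8 / δ / ((n + e : ℕ) : ℝ) ^ n <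
            plantedMass (oracleSamplePMF P.𝒪 P.c
              (encodingBosonInput.encode ⟨n, e, P.b', roundEntries P.b' (firstCols h U)⟩) P.kβ) ι}
              = M ι := by
          ext U
          simp only [Set.mem_setOf_eq, hMdef, IdealParams.massBad, P.idealMass_eq_plantedMass]
        rw [hset]; exact measurableSet_massBad P h δ ι)
    refine le_trans (le_of_eq ?_) key
    congr 1
    refine Finset.sum_congr rfl fun ι _ => ?_
    congr 1
    ext U
    simp only [Set.mem_setOf_eq, hMdef, IdealParams.massBad, P.idealMass_eq_plantedMass]
  -- assemble: average the pointwise union bound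
  set I : ℝ := (Fintype.card (Fin n ↪ Fin (n + e)) : ℝ) with hIdef
  set V : ℝ := (2 : ℝ) ^ P.ℓ₂ with hVdef
  have hT : ∑ u₂ : List.Vector Bool P.ℓ₂, ∑ ι : Fin n ↪ Fin (n + e), μ.real (S u₂ ι) ≤
      I * (V * (1 / (P.kδS : ℝ))) := by
    rw [Finset.sum_comm]
    calc ∑ ι : Fin n ↪ Fin (n + e), ∑ u₂ : List.Vector Bool P.ℓ₂, μ.real (S u₂ ι)
        ≤ ∑ _ι : Fin n ↪ Fin (n + e), V * (1 / (P.kδS : ℝ)) :=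
          Finset.sum_le_sum fun ι _ => (div_le_iff₀' hV).1 (hStock ι)
      _ = I * (V * (1 / (P.kδS : ℝ))) := by
          rw [Finset.sum_const, Finset.card_univ, nsmul_eq_mul]
  have hB : ∑ ι : Fin n ↪ Fin (n + e), μ.real (D ι) ≤ I * (δ / 4) := (div_le_iff₀' hI).1 hDelta
  have hC : ∑ ι : Fin n ↪ Fin (n + e), μ.real (M ι) ≤ I * (δ / 4) := (div_le_iff₀' hI).1 hMass
  have htot : ∑ u₂ : List.Vector Bool P.ℓ₂, ∑ ι : Fin n ↪ Fin (n + e),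
      (μ.real (S u₂ ι) + μ.real (D ι) + μ.real (M ι)) ≤
        I * V * (1 / (P.kδS : ℝ) + δ / 4 + δ / 4) := by
    have hrw : ∑ u₂ : List.Vector Bool P.ℓ₂, ∑ ι : Fin n ↪ Fin (n + e),
        (μ.real (S u₂ ι) + μ.real (D ι) + μ.real (M ι)) =
        (∑ u₂ : List.Vector Bool P.ℓ₂, ∑ ι : Fin n ↪ Fin (n + e), μ.real (S u₂ ι)) +
          V * (∑ ι : Fin n ↪ Fin (n + e), μ.real (D ι)) +
          V * (∑ ι : Fin n ↪ Fin (n + e), μ.real (M ι)) := by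
      simp only [Finset.sum_add_distrib, Finset.sum_const, Finset.card_univ, nsmul_eq_mul, hcardV]
    rw [hrw]
    have hV0 : 0 ≤ V := hV.le
    nlinarith [hT, hB, hC, mul_le_mul_of_nonneg_left hB hV0, mul_le_mul_of_nonneg_left hC hV0]
  calc (∑ u₂ : List.Vector Bool P.ℓ₂, (∑ ι : Fin n ↪ Fin (n + e),
          μ.real {U | idealBad P ε δ (firstCols h U) ι u₂.toList}) / I) / V
      ≤ (∑ u₂ : List.Vector Bool P.ℓ₂, (∑ ι : Fin n ↪ Fin (n + e),
          (μ.real (S u₂ ι) + μ.real (D ι) + μ.real (M ι))) / I) / V := by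
        gcongr with u₂ _ ι _
        exact hunion u₂ ι
    _ = (∑ u₂ : List.Vector Bool P.ℓ₂, ∑ ι : Fin n ↪ Fin (n + e),
          (μ.real (S u₂ ι) + μ.real (D ι) + μ.real (M ι))) / I / V := by
        rw [← Finset.sum_div]
    _ ≤ I * V * (1 / (P.kδS : ℝ) + δ / 4 + δ / 4) / I / V := by gcongr
    _ = 1 / (P.kδS : ℝ) + δ / 4 + δ / 4 := by field_simp

end Literature.Computability.QuantumComplexity
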